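import Summits.Ventures.Crystal3D.Theorems.StickyWulffConstantGenericWallFloorRegisteredResidual
import Summits.Ventures.Crystal3D.Theorems.StickyWulffConstantGenericWallFloorSeparatedWide
import HarnessLib

/-!
# Lane G's residual of record after gen 7: SIX priced one-sided classes, the WIDE separated class, REGISTERED translations
# (crux `GenericWallFloor`, stmt-Ventures-19480, line `WallLedgerG`)

HONEST FRAMING. Venture `Summits/Ventures/Crystal3D` (cell `crystal3d-full`), helper `--supports` the crux `GenericWallFloor`
of `route-Ventures-StickyWulffConstant`, REGISTERED line `WallLedgerG`, open stub `stub_twoSlabAdhesion`.  BOOKKEEPING ONLY;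
F-C1 not moved; NOT the crux: `ExactOnly`(C12-55) [E1] and `StarPairFar` [certified] stay BY NAME and the residual below is
OPEN.  This file intersects the two independent shrinkings of the lane-G residual that landed on 2026-08-28 —
19480-p2 g6's `GenericWallFloorRegisteredResidual` (`…RegisteredResidual`: four priced one-sided `Σ9` classes, REGISTERED
translations only, via `genericWallFloorAt_offReach`) and this seat's `GenericWallFloorCoreResidualWide` (`…CoreResidualWide`:
six priced one-sided `Σ9` classes, wide tilt `‖z ∓ e₃‖ ≤ 1/3`) — and subtracts one more class that the tree prices at
`c₀ = 1` but no residual recorded so far: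
* `SeparatedWideAt A₁ A₂` — SOME wide-tilted steep slot pair (`z₁`, `u₁`; `z₂`, `u₂`) with enough flux
  (`√2|⟪A₁u₁,e₃⟫| + √2|⟪A₂u₂,e₃⟫| ≥ 2`) whose two STACK-FRAME sets are never co-axial (the hypothesis `hsep` of
  `twoSlabAdhesion_stackLedger_local_sep_wide`, p632134) — the class and `genericWallFloorAt_of_separatedWideAt` live in
  `…SeparatedWide` (this seat), with the word cells and p2's ray-separated pairs as named sub-cases.
* `GenericWallFloorRegisteredResidualWide` — the crux's matrix (`GenericWallFloorAt`, `c₀ = 1`) on every non-co-axial,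
  ray-aligned pair outside the six one-sided classes AND outside `SeparatedWideAt` AND registered (`RegisteredAt`, p2 g6);
  **`genericWallFloor_of_registeredResidualWide`**: `ExactOnly`(C12-55) → `StarPairFar` →
  `GenericWallFloorRegisteredResidualWide` → the route decl BY NAME; converses from `GenericWallFloorRegisteredResidual`,
  from `GenericWallFloorCoreResidualWide`, and from the crux (nothing smuggled).
So lane G's kernel debt reads {`ExactOnly`(C12-55) cert, `StarPairFar` cert, `GenericWallFloorRegisteredResidualWide`}:
per residual ORIENTATION pair (≈ 3 % of `Σ9` and of `Σ27` by the seat's Haar censuses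
`calc/tilt_coverage_wide.out`, `calc/tilt_coverage_k3_wide.out` — evidence, not kernel) a COUNTABLE
family of relative translations (the exact registries where coherent lamellae and `T = 0` risers live; R41w).
WHAT THIS IS NOT: a proof of the residual, or any census in the kernel; F-C1 not moved.
-/

noncomputable section

namespace Summit.Ventures.Crystal3D.Theorems

open Summit.Ventures.Crystal3D Finset
open Literature.MathematicalPhysics.StatisticalMechanics (fccStacking barlowStacking IsHaggSeq)
open scoped InnerProductSpace

/-- **Lane G's residual of record after gen 7** (`GenericWallFloorRegisteredResidualWide`): the crux's matrix, verbatim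
(`GenericWallFloorAt`, `c₀ = 1`), on every NON-co-axial, RAY-ALIGNED pair of moved fcc lattices that lies in NONE of the six
priced one-sided `Σ9` classes (record / tilted / wide), is NOT wide-separated, and IS registered. -/
def GenericWallFloorRegisteredResidualWide : Prop :=
  ∀ (A₁ : EuclideanSpace ℝ (Fin 3) ≃ₗᵢ[ℝ] EuclideanSpace ℝ (Fin 3)) (t₁ : EuclideanSpace ℝ (Fin 3))
    (A₂ : EuclideanSpace ℝ (Fin 3) ≃ₗᵢ[ℝ] EuclideanSpace ℝ (Fin 3)) (t₂ : EuclideanSpace ℝ (Fin 3)),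
    ¬ (∃ (L : EuclideanSpace ℝ (Fin 3) ≃ₗᵢ[ℝ] EuclideanSpace ℝ (Fin 3)) (s₁ s₂ : EuclideanSpace ℝ (Fin 3))
        (σ σ' : ℤ → ℤ), IsHaggSeq σ ∧ IsHaggSeq σ' ∧
        (fun p => A₁ p + t₁) '' fccStacking 1 (Real.sqrt (2 / 3)) ⊆
          (fun p => L p + s₁) '' barlowStacking 1 (Real.sqrt (2 / 3)) σ ∧
        (fun p => A₂ p + t₂) '' fccStacking 1 (Real.sqrt (2 / 3)) ⊆
          (fun p => L p + s₂) '' barlowStacking 1 (Real.sqrt (2 / 3)) σ') →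
    RayAlignedAt A₁ A₂ → ¬ Sigma9OneSidedAt A₁ A₂ → ¬ Sigma9OneSidedDownAt A₁ A₂ →
    ¬ Sigma9TiltAt A₁ A₂ → ¬ Sigma9TiltDownAt A₁ A₂ → ¬ Sigma9WideAt A₁ A₂ → ¬ Sigma9WideDownAt A₁ A₂ →
    ¬ SeparatedWideAt A₁ A₂ → RegisteredAt A₁ t₁ A₂ t₂ → GenericWallFloorAt A₁ t₁ A₂ t₂

/-- **The crux BY NAME from `ExactOnly`(C12-55), `StarPairFar` and the residual of record.** -/
theorem genericWallFloor_of_registeredResidualWide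
    {s₀ : EuclideanSpace ℝ (Fin 3)} (hs₀ : s₀ ∈ fccSlots)
    (hcert : ExactOnly 0 (fccSlots.filter fun w => 0 < ⟪w, s₀⟫_ℝ)) (hfar : StarPairFar)
    (hres : GenericWallFloorRegisteredResidualWide) :
    Summit.Ventures.Crystal3D.Theses.StickyWulffConstant.GenericWallFloor := by
  refine genericWallFloor_of_coreResidualWide hs₀ hcert hfar fun A₁ t₁ A₂ t₂ hnc hra h₁ h₂ h₃ h₄ h₅ h₆ => ?_
  by_cases h₇ : SeparatedWideAt A₁ A₂
  · exact genericWallFloorAt_of_separatedWideAt hs₀ hcert hfar h₇ t₁ t₂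
  by_cases hreg : RegisteredAt A₁ t₁ A₂ t₂
  · exact hres A₁ t₁ A₂ t₂ hnc hra h₁ h₂ h₃ h₄ h₅ h₆ h₇ hreg
  · exact genericWallFloorAt_of_not_registeredAt hs₀ hcert hfar hreg

/-- The residual of record is implied by p2 g6's registered residual: nothing is smuggled. -/
theorem genericWallFloorRegisteredResidualWide_of_registeredResidual (h : GenericWallFloorRegisteredResidual) :
    GenericWallFloorRegisteredResidualWide :=
  fun A₁ t₁ A₂ t₂ hnc hra h₁ h₂ h₃ h₄ _ _ _ hreg => h A₁ t₁ A₂ t₂ hnc hra h₁ h₂ h₃ h₄ hreg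

/-- The residual of record is implied by the wide residual: nothing is smuggled. -/
theorem genericWallFloorRegisteredResidualWide_of_coreResidualWide (h : GenericWallFloorCoreResidualWide) :
    GenericWallFloorRegisteredResidualWide :=
  fun A₁ t₁ A₂ t₂ hnc hra h₁ h₂ h₃ h₄ h₅ h₆ _ _ => h A₁ t₁ A₂ t₂ hnc hra h₁ h₂ h₃ h₄ h₅ h₆

/-- The crux implies the residual of record. -/
theorem genericWallFloorRegisteredResidualWide_of_genericWallFloor
    (h : Summit.Ventures.Crystal3D.Theses.StickyWulffConstant.GenericWallFloor) :
    GenericWallFloorRegisteredResidualWide :=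
  genericWallFloorRegisteredResidualWide_of_coreResidualWide (genericWallFloorCoreResidualWide_of_genericWallFloor h)

end Summit.Ventures.Crystal3D.Theorems

end
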